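import Summits.QuantumFields.YangMills.Theorems.ParabolicTrajectoryLatticeGapOnTrajectoryStepScalingDefs
import Summits.QuantumFields.YangMills.Theorems.ParabolicTrajectoryLatticeGapOnTrajectoryStubRateFloor
import Summits.QuantumFields.YangMills.Theorems.ParabolicTrajectoryLatticeGapOnTrajectoryStubFormatSlab
import Summits.QuantumFields.YangMills.Theorems.ParabolicTrajectoryLatticeGapOnTrajectoryStubFormatGap
import Summits.QuantumFields.YangMills.Theorems.ParabolicTrajectoryLatticeGapOnTrajectoryStepScalingFreeAnchor
import Summits.QuantumFields.YangMills.Theorems.ParabolicTrajectoryLatticeGapOnTrajectoryStubRateFloorOct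
import Summits.QuantumFields.YangMills.Theorems.ParabolicTrajectoryLatticeGapOnTrajectoryStubFormatOct
import HarnessLib

/-!
# Crux `LatticeGapOnTrajectory` (stmt-QuantumFields-10523) — skeleton of line `step-scaling-contraction`
# (served slug `StepScalingSketch`; card `Ideas/step-scaling-contraction.md`, round 2, ideator 4;
# skeleton registered by lead a3, reshapes 1–5 by lead c5, continued by lead c6, 2026-08-16)

The finite-volume gap is its own running coupling. For Wilson's measure at `β_k` on the crux's own symmetric
torus of side `2S+1` let `fvGap` be the finite-volume OS gap (best lattice rate `m ∈ [0,1]` of `TorusGapAt`, the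
variance-normalised reflected-autocorrelation decay of all slab observables with ADDITIVE thermal slack
`κ B² e^{−m(2S+1−n−2w)}`) and `ζ_k(S) := (2S+1) · fvGap` its dimensionless form (Defs:
`Theorems/ParabolicTrajectoryLatticeGapOnTrajectoryStepScalingDefs.lean`, p129319). Sub₁ of the landed split
(`Split.LatticeGapOnTrajectoryLat`: `∃ Δ > 0, HasLatticeMassGap ∧ UniformSlabClustering`) follows by iterating a
one-dimensional map: ANCHOR `ζ_k(M^{n_k}) ≥ μ > 0` (`stub_tunedBoxGap` — LANDED p129319 and FREE: it holds for
every scheme with `(κ, μ) = (4e, 1)` by the thermal floor `torusGapAt_of_exp_le`; θ is NOT consumed there), LAW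
`ζ_k(2S) ≥ Φ(ζ_k(S))`, `ζ_k(S') ≥ λ ζ_k(S)` with `Φ` continuous, fixed-point free, `Φ ζ ≥ 2ζ − C` eventually
(`stub_uniformStepScaling`, THE physics — and, after reshape 1, the ONLY place where θ, `β_k → ∞` and simplicity
can enter), LADDER + RATE FLOOR (`stub_rateFloor`, G-blind: such orbits grow like `2^j`, so `fvGap ≥ Δ a_k` on every
`S ≥ M^{n_k}`; downward closure of `TorusGapAt` in the rate uses `osVar ≥ 0`, i.e. site RP, whence the added
hypothesis `β_k → ∞`), FORMAT (G-blind, split at reshape 1 into `stub_formatSlab`: rate floor ⇒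
`UniformSlabClustering` with `p = 0`, `K = 2 + κ`, and `stub_formatGap`: rate floor ⇒ the summit's per-pair
`HasLatticeMassGap`, by torus translation, site reflection, polarisation and thermal absorption `n ≤ S`; both with
`β_k → ∞` added for RP). The crux AS FILED follows through `Split.latticeGapOnTrajectory_of_subs` (p124272) with the
two certified residual stubs `stub_volume` (β) and `stub_symmetrise` (α), which are the restatement diff, not claims.

Reshape 1 (lead c5) relative to a3's registration: `stub_tunedBoxGap` landed (imported, no longer a stub);
`stub_rateFloor` and the format stubs gain the hypothesis `Tendsto sch.β atTop atTop` (available in the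
composition; needed for reflection positivity); `stub_format` ↦ `stub_formatSlab` + `stub_formatGap`.
Reshape 2 (lead c5, after wave 1 landed 3/3): `stub_rateFloor` p129989, `stub_formatSlab` p130133, `stub_formatGap`
p130840 imported — EVERY G-blind piece of the line is now a theorem of the tree; the skeleton has exactly three
sorries left: the physics `stub_uniformStepScaling` and the two residuals `stub_volume` / `stub_symmetrise` of the
FILED crux text (not claimed). Under the planners' restatement `Split.LatticeGapOnTrajectoryRV` (p124272) the line is
CLOSED MODULO ITS PHYSICS STUB: `latticeGapOnTrajectoryLat_of_line` below + `Split.latticeGapOnTrajectoryRV_of_lat`.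
Reshape 3 (lead c5): the physics pair (free anchor p129319 + law `∀ κ₀ …`) MERGED into the weaker `stub_stepScaling :
∃ law μ, 0 < μ ∧ TunedBoxGap … law.κ μ ∧ UniformStepScaling … law` (`stepScaling_of_forall_kappa` records that the old
pair implies it); new registered G-blind helper `tunedBoxGap_of_one_lt` (anchor free for every `κ > 1` under RP) —
LANDED p131344. Reshape 4 (lead c5): octave freedom — the physics stub may start the ladder `J` octaves above the unit
box (`∃ law μ J`, anchor sides `2^J M^{n_k}`); two G-blind wrapper stubs `stub_rateFloorOct` / `stub_formatOct`
generalise p129989 / p130133+p130840 to anchor sides `2^J M^{n_k}` — LANDED p131511 / p131643 (reshape 5: imported). FINAL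
SHAPE: three sorries — `stub_stepScaling` (THE physics) and the two residuals of the filed text.

Disproof.lean (v4.3) used: §2 `concl_iff_split` (the two conclusions of Sub₁ at one rate); §3 (no stub here is
Lean-refutable without a tuned witness, except the G-blind ones, which are claimed TRUE); §4b/§4c zero coupling
(at `β ≡ 0` every slab autocorrelation vanishes for `n ≥ 1`: `TorusGapAt` holds at every rate with `κ ≥ 2`, so
`RateFloor` is junk-reachable and the format stubs are not contradictory — consistent with
`uniformSlabClustering_of_zero_coupling`, p121622); §5 `WithoutSimple`/`WithoutTuning`/`WithoutBeta` are honoured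
ONLY at `stub_uniformStepScaling` (the anchor being free, reshape-1 docstring of that stub); §6 TWO BRANCHES: on the
UV branch the true `ζ` of the unit box is `ε₁ g^{2/3} ≪ 1`, below the thermal floor `log(κ/4)` of the currency — the
law's small-`ζ` regime is governed by the floor, recorded as the line's known weakness (Lines/StepScalingSketch.md).
-/

open scoped ComplexConjugate Topology
open Filter MeasureTheory
open Literature.MathematicalPhysics.QuantumLattice Literature.MathematicalPhysics.QuantumFieldTheory
open Summit.QuantumFields.YangMills.Theses.ParabolicTrajectory
open Summit.QuantumFields.YangMills.Cruxes.LatticeGapOnTrajectory.OrbitKantorovichFiniteSize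

noncomputable section

namespace Summit.QuantumFields.YangMills.Cruxes.LatticeGapOnTrajectory.StepScaling

/-! ## §1 The registered stubs -/

/-- **stub_stepScaling — THE PHYSICS of the line (reshapes 3–4, lead c5: the MERGED and WEAKEST form).** Along
every tuned `M`-adic weak-coupling Wilson scheme of a compact simple `G` there are a volume-doubling law `law`
(continuous `Φ` with `ζ < Φ ζ`, `2ζ − C ≤ Φ ζ` for `ζ ≥ ζ₁`, intermediate factor `λ ∈ (0,1]`, thermal constant
`κ`), an anchor value `μ > 0` and a number of octaves `J` such that, eventually in `k`, the step-scaling variable of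
the box of half-side `2^J M^{n_k}` (physical side `≈ 2^{J+1}`) is at least `μ` (`TunedBoxGap … law.κ μ`) and the law
holds on every torus `S ≥ 2^J M^{n_k}` (`UniformStepScaling … law`). The octave freedom `J` (reshape 4) lets the
prover start the ladder ABOVE the deep-femto boxes of a UV-branch scheme (Disproof §6), where the true `ζ = ε₁g^{2/3}`
sits below the thermal floor `log κ` of the currency: for each FIXED `θ > 0` finitely many octaves reach hadronic
boxes, and with `κ ↓ 1` the floor `log κ ↓ 0` (free anchor `tunedBoxGap_of_one_lt`, p131344). This
replaces a3's pair (`stub_tunedBoxGap`, LANDED p129319 and free; `stub_uniformStepScaling : ∀ κ₀, ∃ law, κ₀ ≤ law.κ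
∧ …`, archived): it is implied by that pair (instantiate `κ₀ := 4e`, `μ := 1`, `J := 0`), it no longer asks the law to live
with arbitrarily large thermal constants (whose free floor `log(κ/4)` pollutes the small-`ζ` regime, Disproof §6 UV
branch), and it lets its prover choose: EITHER `law.κ > 1`, where the anchor conjunct is FREE eventually
(`β_k ≥ 0`: reflection positivity + the covariance bound `‖osCorr‖ ≤ B²` give `TorusGapAt` at every rate
`≤ log κ/(2S+1)`; registered helper `tunedBoxGap_of_one_lt`, and `tunedBoxGap_of_exp_le` p129319 for `κ ≥ 4e^μ`)
and ALL the content is the doubling law read with a floor `log κ`, OR `law.κ ≤ 1` (floor-free currency), where the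
anchor is Lüscher's femto-universe gap / the tuning (`θ` enters) and the law is asymptotic freedom (small `ζ`:
`Φ(ζ)/ζ − 1 ≍ b₀ g²`) plus the mass gap in finite-size form (no fixed point at `ζ = O(1)`; `Φ ζ ≈ 2ζ` minus the
finite-size mass shift at large `ζ`). False for an abelian factor (free photons: a fixed point of the doubling
map), as it must be (Disproof `WithoutSimple`); no law at a finite-β bulk transition (`WithoutBeta`); honours
`WithoutTuning` only through the `κ ≤ 1` reading. The ONLY stub of the line using `IsCompactSimpleLieGroup`, `θ`
and `β_k → ∞` as physics. Junk audit (Disproof §4c analogue): its CONCLUSION is reachable at `β ≡ 0`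
(`stepScalingConcl_of_zero_coupling`, LANDED p131955: `fvGap = 1`, `ζ = 2S+1`, `Φ ζ = max(2ζ−1, ζ+1)`), so the
currency is not contradictory and `StepLaw` is inhabited; `β_k → ∞` excludes that point. -/
theorem stub_stepScaling :
    ∀ (G : Type) [Group G] [TopologicalSpace G] [IsTopologicalGroup G] [CompactSpace G]
      [MeasurableSpace G] [BorelSpace G], IsCompactSimpleLieGroup G →
      ∀ (r : LatticeRep G) (M : ℕ) (θ : ℝ) (sch : SpeciesScheme (YMSpecies G)) (n : ℕ → ℕ),
        2 ≤ M → 0 < θ → (∀ k, sch.a k = ((M : ℝ) ^ n k)⁻¹) → Tendsto sch.β atTop atTop →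
        Tendsto (fun k => ((M : ℝ) ^ n k) ^ 8 *
            latticeConnectedCorr r.ρ (sch.β k) (sch.side k) r.curvature.F r.curvature.F (M ^ n k))
          atTop (𝓝 θ) →
        ∃ (law : StepLaw) (μ : ℝ) (J : ℕ), 0 < μ ∧ TunedBoxGap r sch (fun k => 2 ^ J * M ^ n k) law.κ μ ∧
          UniformStepScaling r sch (fun k => 2 ^ J * M ^ n k) law := by
  sorry

/-! `stub_rateFloorOct` (ladder + rate floor from an anchor `J` octaves up, `Δ = λc/(5·2^J)`): LANDED p131511 — `Theorems/ParabolicTrajectoryLatticeGapOnTrajectoryStubRateFloorOct.lean` (imported). -/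


/-! `stub_formatOct` (rate floor `J` octaves up ⇒ `HasLatticeMassGap ∧ UniformSlabClustering`; `2^J M^{n_k} ≤ L_k` eventually, `eventually_octave_le_L`): LANDED p131643 — `Theorems/ParabolicTrajectoryLatticeGapOnTrajectoryStubFormatOct.lean` (imported; helpers `hasLatticeMassGap_of_rateFloorOct`, `uniformSlabClustering_of_rateFloorOct`). -/


/-! **Registered helper (not a composition stub): `tunedBoxGap_of_one_lt`** — the anchor is free for every thermal
constant `κ > 1` (G-blind; registered on the item by `stub-add`, reshape 3; LANDED p131344 as
`Theorems/ParabolicTrajectoryLatticeGapOnTrajectoryStepScalingFreeAnchor.lean`):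
`∀ G … (r : LatticeRep G) (sch : SpeciesScheme (YMSpecies G)) (D : ℕ → ℕ) (κ : ℝ), Tendsto sch.β atTop atTop →
(∀ᶠ k in atTop, 1 ≤ D k) → 1 < κ → TunedBoxGap r sch D κ (min 1 (Real.log κ))`.
Sharper than `tunedBoxGap_of_exp_le` (p129319, `κ ≥ 4e^μ`): under site reflection positivity (`β ≥ 0`, `w < S`,
`stub_negReflectRP` p120012 via `HankelSite.osVar_negReflect_nonneg_of_rp_lt` p120231) the `osVar` term is
non-negative, and by the `Θ₀`- and `τ`-invariance of Wilson's torus measure the reflected translated correlation is a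
genuine covariance, `‖osCorr μ Θ₀ τ_n X X‖ ≤ ∫‖X − ∫X‖² ≤ B²`; so `TorusGapAt ρ β S (μ/(2S+1)) κ` holds whenever
`e^μ ≤ κ`. Consumed by whoever proves `stub_stepScaling` with `law.κ > 1`. -/


/-! `stub_rateFloor` (ladder + rate floor; reshape 1 with `β_k → ∞`): LANDED p129989 — `Theorems/ParabolicTrajectoryLatticeGapOnTrajectoryStubRateFloor.lean` (imported; helpers `StepLaw.exists_ladder_const`, `exists_dyadic_bracket`, `kappa_nonneg_of_torusGapAt`, `torusGapAt_anti`, `torusGapAt_of_ladder`). -/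


/-! `stub_formatSlab` (rate floor ⇒ `UniformSlabClustering`, `p = 0`, `K = 2 + κ`): LANDED p130133 — `Theorems/ParabolicTrajectoryLatticeGapOnTrajectoryStubFormatSlab.lean` (imported). -/


/-! `stub_formatGap` (rate floor ⇒ the summit's per-pair `HasLatticeMassGap`; slab width `2w₀+2`, shift `2S−w₀−1`, separation `n−2w₀−3`, pair constant `(4(C_A²+C_B²) + κ(C_A+C_B)² + 2C_AC_B)e^{Δ(2w₀+3)}`): LANDED p130840 — `Theorems/ParabolicTrajectoryLatticeGapOnTrajectoryStubFormatGap.lean` (imported; helpers `latticeConnectedCorr_eq_torusTimeShift`, `abs_latticeConnectedCorr_le_of_torusGapAt`, …). -/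


/-- **RESIDUAL (β), not a claim of the line**: the volume clause `a_k L_k / log(a_k⁻¹) → ∞` from the crux
hypotheses — the typed restatement diff certified by seven leads (`Split.VolumeGrowthOnTrajectory`, p124272;
signature shared verbatim with the okfs and sparse-defect skeletons). -/
theorem stub_volume : Split.VolumeGrowthOnTrajectory := by
  sorry

/-- **RESIDUAL (α), not a claim of the line**: symmetric polynomially-bounded transfer ⇒ the filed all-`sch'`
transfer clause — the typed restatement diff certified by seven leads (`Split.SymmetrisationOnTrajectory`,
p124272; Müntz obstruction `Negative/TransferObstruction.lean`; shared verbatim). -/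
theorem stub_symmetrise : Split.SymmetrisationOnTrajectory := by
  sorry

/-! ## §2 The composition -/

/-- **Sub₁ from the stubs**: the merged physics stub (law + anchor, `J` octaves up), the octave ladder/rate floor and
the octave format stub; `0 ≤ law.κ` is read off the rate floor itself (`kappa_nonneg_of_torusGapAt`, p129989). -/
theorem latticeGapOnTrajectoryLat_of
    (hP : ∀ (G : Type) [Group G] [TopologicalSpace G] [IsTopologicalGroup G] [CompactSpace G]
      [MeasurableSpace G] [BorelSpace G], IsCompactSimpleLieGroup G →
      ∀ (r : LatticeRep G) (M : ℕ) (θ : ℝ) (sch : SpeciesScheme (YMSpecies G)) (n : ℕ → ℕ),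
        2 ≤ M → 0 < θ → (∀ k, sch.a k = ((M : ℝ) ^ n k)⁻¹) → Tendsto sch.β atTop atTop →
        Tendsto (fun k => ((M : ℝ) ^ n k) ^ 8 *
            latticeConnectedCorr r.ρ (sch.β k) (sch.side k) r.curvature.F r.curvature.F (M ^ n k))
          atTop (𝓝 θ) →
        ∃ (law : StepLaw) (μ : ℝ) (J : ℕ), 0 < μ ∧ TunedBoxGap r sch (fun k => 2 ^ J * M ^ n k) law.κ μ ∧
          UniformStepScaling r sch (fun k => 2 ^ J * M ^ n k) law)
    (hR : ∀ (G : Type) [Group G] [TopologicalSpace G] [IsTopologicalGroup G] [CompactSpace G]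
      [MeasurableSpace G] [BorelSpace G] (r : LatticeRep G) (M : ℕ) (sch : SpeciesScheme (YMSpecies G))
      (n : ℕ → ℕ) (law : StepLaw) (μ : ℝ) (J : ℕ),
        2 ≤ M → (∀ k, sch.a k = ((M : ℝ) ^ n k)⁻¹) → Tendsto sch.β atTop atTop → 0 < μ →
        TunedBoxGap r sch (fun k => 2 ^ J * M ^ n k) law.κ μ →
        UniformStepScaling r sch (fun k => 2 ^ J * M ^ n k) law →
        ∃ Δ : ℝ, 0 < Δ ∧ RateFloor r sch (fun k => 2 ^ J * M ^ n k) law.κ Δ)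
    (hF : ∀ (G : Type) [Group G] [TopologicalSpace G] [IsTopologicalGroup G] [CompactSpace G]
      [MeasurableSpace G] [BorelSpace G] (r : LatticeRep G) (M : ℕ) (sch : SpeciesScheme (YMSpecies G))
      (n : ℕ → ℕ) (J : ℕ) (κ Δ : ℝ),
        2 ≤ M → (∀ k, sch.a k = ((M : ℝ) ^ n k)⁻¹) → Tendsto sch.β atTop atTop → 0 ≤ κ → 0 < Δ →
        RateFloor r sch (fun k => 2 ^ J * M ^ n k) κ Δ →
        HasLatticeMassGap r sch Δ ∧ Transfer.UniformSlabClustering r sch Δ) :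
    Split.LatticeGapOnTrajectoryLat := by
  intro G _ _ _ _ _ _ hG r M θ sch n hM hθ hshape hβ htune
  obtain ⟨law, μ, J, hμ, hbox, hlaw⟩ := hP G hG r M θ sch n hM hθ hshape hβ htune
  obtain ⟨Δ, hΔ, hfloor⟩ := hR G r M sch n law μ J hM hshape hβ hμ hbox hlaw
  -- `0 ≤ law.κ` from the rate floor at any `S ≥ 1`
  have hκ0 : 0 ≤ law.κ := by
    have hM1 : 1 ≤ M := by omega
    obtain ⟨k, hk⟩ := hfloor.exists
    have h1 : 1 ≤ 2 ^ J * M ^ n k := Nat.one_le_iff_ne_zero.2 (by positivity)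
    exact kappa_nonneg_of_torusGapAt r.continuous (sch.β k) h1 (hk (2 ^ J * M ^ n k) le_rfl)
  obtain ⟨hgap, hslab⟩ := hF G r M sch n J law.κ Δ hM hshape hβ hκ0 hΔ hfloor
  exact ⟨Δ, hΔ, hgap, hslab⟩

/-- **a3's pair implies the merged stub** (so reshape 3 only WEAKENED the physics obligation): the landed free
anchor `stub_tunedBoxGap` (p129319) and the archived law stub in its `∀ κ₀` form give `stub_stepScaling`'s
conclusion. -/
theorem stepScaling_of_forall_kappa
    (hU : ∀ (G : Type) [Group G] [TopologicalSpace G] [IsTopologicalGroup G] [CompactSpace G]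
      [MeasurableSpace G] [BorelSpace G], IsCompactSimpleLieGroup G →
      ∀ (r : LatticeRep G) (M : ℕ) (θ : ℝ) (sch : SpeciesScheme (YMSpecies G)) (n : ℕ → ℕ),
        2 ≤ M → 0 < θ → (∀ k, sch.a k = ((M : ℝ) ^ n k)⁻¹) → Tendsto sch.β atTop atTop →
        Tendsto (fun k => ((M : ℝ) ^ n k) ^ 8 *
            latticeConnectedCorr r.ρ (sch.β k) (sch.side k) r.curvature.F r.curvature.F (M ^ n k))
          atTop (𝓝 θ) →
        ∀ κ₀ : ℝ, ∃ law : StepLaw, κ₀ ≤ law.κ ∧ UniformStepScaling r sch (fun k => M ^ n k) law) :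
    ∀ (G : Type) [Group G] [TopologicalSpace G] [IsTopologicalGroup G] [CompactSpace G]
      [MeasurableSpace G] [BorelSpace G], IsCompactSimpleLieGroup G →
      ∀ (r : LatticeRep G) (M : ℕ) (θ : ℝ) (sch : SpeciesScheme (YMSpecies G)) (n : ℕ → ℕ),
        2 ≤ M → 0 < θ → (∀ k, sch.a k = ((M : ℝ) ^ n k)⁻¹) → Tendsto sch.β atTop atTop →
        Tendsto (fun k => ((M : ℝ) ^ n k) ^ 8 *
            latticeConnectedCorr r.ρ (sch.β k) (sch.side k) r.curvature.F r.curvature.F (M ^ n k))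
          atTop (𝓝 θ) →
        ∃ (law : StepLaw) (μ : ℝ) (J : ℕ), 0 < μ ∧ TunedBoxGap r sch (fun k => 2 ^ J * M ^ n k) law.κ μ ∧
          UniformStepScaling r sch (fun k => 2 ^ J * M ^ n k) law := by
  intro G _ _ _ _ _ _ hG r M θ sch n hM hθ hshape hβ htune
  obtain ⟨κ, μ, _, hμ, hbox⟩ := stub_tunedBoxGap G hG r M θ sch n hM hθ hshape hβ htune
  obtain ⟨law, hκlaw, hlaw⟩ := hU G hG r M θ sch n hM hθ hshape hβ htune κ
  have hD : (fun k => 2 ^ 0 * M ^ n k) = fun k => M ^ n k := funext fun k => by simp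
  refine ⟨law, μ, 0, hμ, ?_, ?_⟩
  · rw [hD]; exact tunedBoxGap_mono_kappa r sch _ hκlaw hbox
  · rw [hD]; exact hlaw

/-- **Sub₁ from the line**: `Split.LatticeGapOnTrajectoryLat` modulo the physics stub `stub_stepScaling` alone
(every other ingredient is a theorem of the tree). -/
theorem latticeGapOnTrajectoryLat_of_line : Split.LatticeGapOnTrajectoryLat :=
  latticeGapOnTrajectoryLat_of stub_stepScaling stub_rateFloorOct stub_formatOct

/-- **The repaired crux (B) of the restatement** (`Split.LatticeGapOnTrajectoryRV`, text of
`Cruxes/…/RestatementC2.lean`, landed p124272) from the line, modulo the physics stub alone. -/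
theorem latticeGapOnTrajectoryRV_of_line : Split.LatticeGapOnTrajectoryRV :=
  Split.latticeGapOnTrajectoryRV_of_lat latticeGapOnTrajectoryLat_of_line

/-- **The skeleton closes the crux BY NAME** (no hypotheses; `sorry` only inside the registered stubs it
invokes): the live stubs give Sub₁ (`latticeGapOnTrajectoryLat_of`), and the landed glue
`Split.latticeGapOnTrajectory_of_subs` (p124272) composes it with the two residual stubs into
`LatticeGapOnTrajectory` as filed. -/
theorem LatticeGapOnTrajectory_of : LatticeGapOnTrajectory :=
  Split.latticeGapOnTrajectory_of_subs latticeGapOnTrajectoryLat_of_line stub_volume stub_symmetrise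

end Summit.QuantumFields.YangMills.Cruxes.LatticeGapOnTrajectory.StepScaling

end
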